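import Summits.Ventures.Crystal3D.Bulk.GapReduction
import Summits.Ventures.Crystal3D.Bulk.SharperConstant
import HarnessLib

/-!
# GAP(δ) ∧ CLASSIFICATION(δ) ⇒ bulk crystallization with `K = 702` (all-but-one form)

HONEST FRAMING. Part of the venture `Summits/Ventures/Crystal3D` (cell `pub-crystal3d`, phase 2,
`PLAN.md` R41; seat typer-bulk-2). `Bulk/GapReduction.lean` proves
`KissingGap δ → KissingClassification δ → BulkCrystallization3D 1296` for any one gap `δ`;
`Bulk/SharperConstant.lean` proves the constant `702 = 13 · 54` from the ALL-BUT-ONE form of the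
local lemma at Hales's gap `2h₀`. This file combines the two: the all-but-one form holds under
GAP(δ) ∧ CLASSIFICATION(δ) for ANY `δ` (for a non-touching pair of neighbours of the centre it
suffices that ONE of the two is twelve-kissed — GAP at that one separates the pair), hence

  `KissingGap δ → KissingClassification δ → BulkCrystallization3D 702`,

and the instances (G2) `BoroczkySzabo2015_thm3 → KissingClassification 2.51838585 →
BulkCrystallization3D 702` and `GapTupleDiam d₀ → KissingClassification (2 d₀) →
BulkCrystallization3D 702`. So whichever gap the cell's census certifies, the constant is `702`.
Everything is elementary given the inputs named in each statement; NO unconditional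
crystallization theorem is claimed.
-/

noncomputable section

open scoped BigOperators
open Finset

namespace Summit.Ventures.Crystal3D

open Literature.Geometry.DiscreteGeometry

/-- **Shells are `δ`-gap configurations, all-but-one form.** If `u` is touched by twelve balls
of the packing `V` and every ball touching `u`, except possibly the one centred at `w₀`, is itself
touched by twelve, then the kissing shell of `u` is a `δ`-gap kissing configuration: of two
distinct non-touching shell points at most one is `w₀ - u`, and GAP(δ) at the other separates
them. -/
theorem isGapKissingConfig_kissingShell_allButOne {δ : ℝ} (hg : KissingGap δ)
    {V : Set (EuclideanSpace ℝ (Fin 3))} {u : EuclideanSpace ℝ (Fin 3)} (hV : IsUnitBallPacking V)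
    (h12 : (kissingShell V u).ncard = 12) (w₀ : EuclideanSpace ℝ (Fin 3))
    (hnb : ∀ w ∈ V, dist u w = 2 → w ≠ w₀ → (kissingShell V w).ncard = 12) :
    IsGapKissingConfig δ (kissingShell V u) := by
  refine ⟨h12, fun y hy => hy.2, fun y hy z hz => ?_⟩
  by_cases hyz : y = z
  · exact Or.inl hyz
  have hwy : dist u (u + y) = 2 := by rw [dist_eq_norm, sub_add_cancel_left, norm_neg, hy.2]
  have hwz : dist u (u + z) = 2 := by rw [dist_eq_norm, sub_add_cancel_left, norm_neg, hz.2]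
  -- at least one of the two neighbours `u + y`, `u + z` is not the exceptional one
  by_cases hy₀ : u + y = w₀
  · have hz₀ : u + z ≠ w₀ := fun h => hyz (add_left_cancel (hy₀.trans h.symm))
    have h := hg V hV (u + z) hz.1 (hnb (u + z) hz.1 hwz hz₀) (u + y) hy.1
    rw [dist_add_left, dist_comm] at h
    rcases h with h | h
    · exact Or.inl (add_left_cancel h).symm
    · exact Or.inr h
  · have h := hg V hV (u + y) hy.1 (hnb (u + y) hy.1 hwy hy₀) (u + z) hz.1
    rw [dist_add_left] at h
    rcases h with h | h
    · exact Or.inl (add_left_cancel h)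
    · exact Or.inr h

/-- **The reduction at one ball, all-but-one form.** Under GAP(δ) and CLASSIFICATION(δ): a ball
with twelve contacts all of whose contact neighbours except possibly `j₀` have twelve contacts has
a close-packed (FCC or HCP) first shell. -/
theorem isClosePackedShell_of_gap_of_classification_allButOne {δ : ℝ} (hg : KissingGap δ)
    (hc : KissingClassification δ) {N : ℕ} {x : Fin N → EuclideanSpace ℝ (Fin 3)}
    (hx : IsUnitPacking x) {i : Fin N} (j₀ : Fin N) (hi : coordination x i = 12)
    (hnb : ∀ j ∈ contactNeighbors x i, j ≠ j₀ → coordination x j = 12) :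
    IsClosePackedShell x i := by
  have hV := ((isUnitPacking_iff_two_smul x).1 hx).2
  rw [IsClosePackedShell, ← kissingShell_two_smul_range_eq_contactShell]
  refine hc _ (isGapKissingConfig_kissingShell_allButOne hg hV ?_ ((2 : ℝ) • x j₀)
    fun w hw hd hw₀ => ?_)
  · rw [kissingShell_two_smul_range_eq_contactShell, ncard_contactShell hx, hi]
  · obtain ⟨j, hj, rfl⟩ := exists_mem_contactNeighbors_of_dist_two_smul hw hd
    have hjj₀ : j ≠ j₀ := fun h => hw₀ (by rw [h])
    rw [kissingShell_two_smul_range_eq_contactShell, ncard_contactShell hx, hnb j hj hjj₀]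

/-- Under GAP(δ) ∧ CLASSIFICATION(δ), a saturated ball with a non-close-packed shell has two
distinct unsaturated contact neighbours. -/
theorem two_unsaturated_of_not_isClosePackedShell_of_gap {δ : ℝ} (hg : KissingGap δ)
    (hc : KissingClassification δ) {N : ℕ} {x : Fin N → EuclideanSpace ℝ (Fin 3)}
    (hx : IsUnitPacking x) {i : Fin N} (hi : coordination x i = 12)
    (hnot : ¬ IsClosePackedShell x i) :
    ∃ j ∈ contactNeighbors x i, ∃ j' ∈ contactNeighbors x i,
      j ≠ j' ∧ coordination x j ≠ 12 ∧ coordination x j' ≠ 12 := by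
  have h1 : ∃ j ∈ contactNeighbors x i, coordination x j ≠ 12 := by
    by_contra h
    exact hnot (isClosePackedShell_of_gap_of_classification_allButOne hg hc hx i hi
      fun j hj _ => by by_contra hj12; exact h ⟨j, hj, hj12⟩)
  obtain ⟨j, hj, hj12⟩ := h1
  have h2 : ∃ j' ∈ contactNeighbors x i, j' ≠ j ∧ coordination x j' ≠ 12 := by
    by_contra h
    exact hnot (isClosePackedShell_of_gap_of_classification_allButOne hg hc hx j hi
      fun j' hj' hne => by by_contra hj12'; exact h ⟨j', hj', hne, hj12'⟩)
  obtain ⟨j', hj', hne, hj12'⟩ := h2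
  exact ⟨j, hj, j', hj', hne.symm, hj12, hj12'⟩

/-- **GAP(δ) ∧ CLASSIFICATION(δ) ⇒ bulk crystallization with `K = 702`**, for any one `δ`: in
every sticky ground state of `N` hard unit spheres in `ℝ³` all but at most `702·N^{2/3}` balls
have an FCC or HCP first shell. -/
theorem bulkCrystallization3D_sharp_of_gap_of_classification {δ : ℝ} (hg : KissingGap δ)
    (hc : KissingClassification δ) : BulkCrystallization3D 702 := fun _N _x hx =>
  hx.card_le_of_two_unsaturated_neighbors fun _i hi h12 =>
    two_unsaturated_of_not_isClosePackedShell_of_gap hg hc hx.1 h12 (mem_nonClosePacked.1 hi)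

/-- **(G2) with `K = 702`**: Böröczky–Szabó's gap `2.51838585` and a certified classification at
that gap give `BulkCrystallization3D 702`. -/
theorem bulkCrystallization3D_sharp_of_boroczkySzabo_of_classification
    (hBS : BoroczkySzabo2015_thm3) (hc : KissingClassification 2.51838585) :
    BulkCrystallization3D 702 :=
  bulkCrystallization3D_sharp_of_gap_of_classification (kissingGap_of_gapTuple hBS) hc

/-- **(G1') with `K = 702`**: a certified `GapTupleDiam d₀` (diameter-one engines) and a
classification at gap `2 d₀` give `BulkCrystallization3D 702`. -/
theorem bulkCrystallization3D_sharp_of_gapTupleDiam_of_classification {d₀ : ℝ}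
    (hg : GapTupleDiam d₀) (hc : KissingClassification (2 * d₀)) : BulkCrystallization3D 702 :=
  bulkCrystallization3D_sharp_of_gap_of_classification
    (kissingGap_of_gapTuple ((gapTupleDiam_iff d₀).1 hg)) hc

end Summit.Ventures.Crystal3D

end
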